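import Summits.BirchSwinnertonDyer.BirchSwinnertonDyer.Theorems.AlignedTransportAtTwoMainConjectureOfRankZeroBSDAtTwoCubicTowerGrowth
import HarnessLib

/-!
# Route `AlignedTransportAtTwo`, crux C2 `MainConjectureOfRankZeroBSDAtTwo` (stmt-BirchSwinnertonDyer-22298):
# THE `2`-CLASS NUMBER JUMPS AT EVERY LAYER of the cyclotomic `ℤ₂`-tower of a Kilford cubic field — the ORDER-form Fukuda door is void on the
# Kilford stratum; `μ = 0 ⟹ λ ≥ 1`; cubic and seed-cell forms

HONEST FRAMING (cell `bsd-f1-sign2`, WIDTH-5 attached prover seat `bsd-line-att-p3` gen 25 on line `birth` of the lead `bsd-line-att-p2`;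
`--supports` stmt-BirchSwinnertonDyer-22298, closes nothing; BSD is NOT proved by any of this; the crux C2, its verdict «blocked-on
`Rank1Residual.GreenbergMuConjectureIrreducible`» and every registered stub are untouched). THEOREMS ONLY — no definition, no named fact,
no `sorry`; «three places above `2` in `ℚ(β)`» stays a DISPLAYED hypothesis exactly as in att-p5 g25's `…CubicLayerOneDoors`.

Sequel of `…CubicTowerGrowth` (this seat: Chevalley at every cyclic layer, `e_0 + m·n ≤ e_n + 2n + 1`; with three places above `2`,
`e_n ≥ e_0 + n − 1`). Here:
* §3 (Fukuda): `K` of odd degree and unit rank `1`, `κ` cyclotomic, all places above `2` of odd index, at least three of them: with Fukuda 1994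
  Thm. 1 (1) (tree `fukuda1994_thm1_classNumberPExp_const_of_succ_eq_holds`, PROVED, Fukuda index `0`) **`e_{n+1} ≠ e_n` for EVERY `n`**
  (`classNumberPExp_succ_ne`, `not_exists_classNumberPExp_succ_eq`); READING: any eventual linear law `e_n = l·n + ν` (Iwasawa's formula with
  `μ = 0`, the tree's `ClassicalMuVanishes`) has `l ≥ 1` (`one_le_slope_of_linear_growth`) — the cubic analogue of «`λ_p ≥ 1` for an imaginary
  quadratic field in which `p` splits» (`s` totally ramified places above `p`, unit rank `u`, `s ≥ u + 2`).
* §4 (cubic currency): complex cubic `F` (one real place) with three places above `2`: `e_0 + n ≤ e_n + 1`, `e_{n+1} ≠ e_n`,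
  `¬ ∃ n, e_{n+1} = e_n`, `μ = 0 ⟹ λ ≥ 1`.
* §5 (crux C2): `W` elliptic, `Δ_W < 0`, no rational `2`-torsion abscissa, `β` a root of the `2`-division cubic, three places above `2` in `ℚ(β)`
  (all twelve certified seeds): the same for every cyclotomic `κP` of `ℚ(β)`, and **the displayed certificate «`∀ κP, ∃ n, e_{n+1}(κP) = e_n(κP)`»
  of the ORDER-form door `…CubicLayerOneDoors.mazurMainConjecture_two_of_muIneqRel_of_threePrimes_of_classNumberPExp_succ_eq` is FALSE**
  (`not_forall_exists_classNumberPExp_succ_eq_seedCubicField`) — only the RANK-form door (Fukuda Thm. 1 (2): `2`-ranks of `Cl(ℚ(β)_n)`) can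
  certify H3M⁻ on the Kilford stratum. For -data: the census ask of `Cruxes/…/KILFORD-CUBIC-TOWER-att-p5-g25.md` §3 loses its «`e₂ = e₁`» branch.

References: [Fukuda1994] Thm. 1 (1)(2), p. 264; [Lang1990] Ch. 5 §1 Thm. 1.2, Ch. 13 §4 Lemma 4.1–4.2; [Washington1997] §13.1, §13.3 Thm. 13.13;
[Cohen1993] Prop. 4.8.11; tree p742953/p743166 (att-p5 g25), `Fukuda1994Thm1Proofs`, `…CubicTowerGrowth`.
-/

set_option linter.dupNamespace false
set_option autoImplicit false

noncomputable section

open scoped Classical NumberField nonZeroDivisors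

namespace Summit.BirchSwinnertonDyer.BirchSwinnertonDyer.Theorems.AlignedTransportAtTwoCubicTowerJumps

open NumberField IsDedekindDomain
open Literature.NumberTheory.NumberFields Literature.NumberTheory.GaloisRepresentations Literature.NumberTheory.IwasawaTheory
  Literature.NumberTheory.EllipticCurves
  Summit.BirchSwinnertonDyer.BirchSwinnertonDyer.Theorems.AddKatoTwo
  Summit.BirchSwinnertonDyer.BirchSwinnertonDyer.Theorems.AlignedTransportAtTwoCubicLayerOneParity
  Summit.BirchSwinnertonDyer.BirchSwinnertonDyer.Theorems.AlignedTransportAtTwoCubicLayerOneDoors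
  Summit.BirchSwinnertonDyer.BirchSwinnertonDyer.Theorems.AlignedTransportAtTwoCubicTowerGrowth

/-! ## §3 Fukuda: the `2`-class number jumps at EVERY layer; `λ ≥ 1`; cubic and seed forms -/

section Fukuda

variable {K : Type} [Field K] [NumberField K]

/-- **`e_{n+1} ≠ e_n` for EVERY `n`.** `K` of odd degree and unit rank `1`, `κ` cyclotomic, all places above `2` of odd index and at least
THREE of them: two consecutive layers never have the same `2`-class number. (If `e_{n+1} = e_n`, Fukuda's Thm. 1 (1) — tree
`fukuda1994_thm1_classNumberPExp_const_of_succ_eq_holds`, Fukuda index `0` — makes `e_m` constant for `m ≥ n`, contradicting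
`e_m ≥ e_0 + m − 1` of §2.) [cite: Fukuda1994, Thm. 1 (1), p. 264] [cite: Lang1990, Ch. 13 §4, Lemma 4.1–4.2] -/
theorem classNumberPExp_succ_ne (hK2 : ¬ 2 ∣ Module.finrank ℚ K) (hrank : Units.rank K = 1)
    (κ : ZpExtension K 2) (hκ : κ.IsCyclotomic)
    (hodd : ∀ w : HeightOneSpectrum (𝓞 K), ((2 : ℕ) : 𝓞 K) ∈ w.asIdeal → Odd (w.asIdeal.ramificationIdx ℤ))
    (h3 : 3 ≤ {w : HeightOneSpectrum (𝓞 K) | ((2 : ℕ) : 𝓞 K) ∈ w.asIdeal}.ncard) (n : ℕ) :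
    classNumberPExp κ (n + 1) ≠ classNumberPExp κ n := by
  intro he
  have hram : TotallyRamifiedFrom κ 0 := totallyRamifiedFrom_zero_of_forall_odd_ramificationIdx hK2 κ hκ hodd
  have hconst := fukuda1994_thm1_classNumberPExp_const_of_succ_eq_holds K 2 κ 0 hram n (Nat.zero_le n) he
    (n + classNumberPExp κ n + 2) (by omega)
  have hgrow := classNumberPExp_zero_add_le_layer_of_three_le hK2 hrank κ hκ hodd h3 (n + classNumberPExp κ n + 2)
  omega

/-- **No layer pair `(n, n+1)` with equal `2`-class numbers** (the hypothesis of the ORDER form of Fukuda's door is unsatisfiable).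
[cite: Fukuda1994, Thm. 1 (1), p. 264] -/
theorem not_exists_classNumberPExp_succ_eq (hK2 : ¬ 2 ∣ Module.finrank ℚ K) (hrank : Units.rank K = 1)
    (κ : ZpExtension K 2) (hκ : κ.IsCyclotomic)
    (hodd : ∀ w : HeightOneSpectrum (𝓞 K), ((2 : ℕ) : 𝓞 K) ∈ w.asIdeal → Odd (w.asIdeal.ramificationIdx ℤ))
    (h3 : 3 ≤ {w : HeightOneSpectrum (𝓞 K) | ((2 : ℕ) : 𝓞 K) ∈ w.asIdeal}.ncard) :
    ¬ ∃ n : ℕ, classNumberPExp κ (n + 1) = classNumberPExp κ n := fun ⟨n, hn⟩ =>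
  classNumberPExp_succ_ne hK2 hrank κ hκ hodd h3 n hn

/-- **`λ ≥ 1` in growth form.** Under the same hypotheses, any eventual linear law `e_n = l·n + ν` (`n ≥ n₀`) — Iwasawa's growth formula with
`μ = 0`, the tree's `ClassicalMuVanishes κ` — has slope `l ≥ 1`: the tower of a complex cubic field in which `2` splits completely is the
cubic analogue of an imaginary quadratic field in which `p` splits (`λ_p ≥ 1`). [cite: Lang1990, Ch. 5 §1 Thm. 1.2 and Ch. 13 §4]
[cite: Washington1997, §13.3 Thm. 13.13] -/
theorem one_le_slope_of_linear_growth (hK2 : ¬ 2 ∣ Module.finrank ℚ K) (hrank : Units.rank K = 1)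
    (κ : ZpExtension K 2) (hκ : κ.IsCyclotomic)
    (hodd : ∀ w : HeightOneSpectrum (𝓞 K), ((2 : ℕ) : 𝓞 K) ∈ w.asIdeal → Odd (w.asIdeal.ramificationIdx ℤ))
    (h3 : 3 ≤ {w : HeightOneSpectrum (𝓞 K) | ((2 : ℕ) : 𝓞 K) ∈ w.asIdeal}.ncard)
    {l : ℕ} {ν : ℤ} {n₀ : ℕ} (hlin : ∀ n, n₀ ≤ n → (classNumberPExp κ n : ℤ) = l * n + ν) : 1 ≤ l := by
  by_contra hl
  have hl0 : l = 0 := by omega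
  subst hl0
  -- `e_n = ν` for `n ≥ n₀`, against `e_n ≥ e_0 + n − 1`
  set N : ℕ := n₀ + ν.toNat + 2 with hN
  have h1 := hlin N (by omega)
  have h2 := hlin n₀ le_rfl
  have hgrow := classNumberPExp_zero_add_le_layer_of_three_le hK2 hrank κ hκ hodd h3 N
  simp only [Nat.cast_zero, zero_mul, zero_add] at h1 h2
  have hν : (classNumberPExp κ n₀ : ℤ) = ν := h2
  have hνN : (classNumberPExp κ N : ℤ) = ν := h1
  have : (N : ℤ) ≤ (classNumberPExp κ N : ℤ) + 1 := by exact_mod_cast (le_trans (Nat.le_add_left N _) hgrow)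
  have hνnn : 0 ≤ ν := by rw [← hν]; exact_mod_cast Nat.zero_le _
  have : (ν.toNat : ℤ) = ν := Int.toNat_of_nonneg hνnn
  omega

/-- **`μ = 0 ⟹ λ ≥ 1`** for such towers, in the tree's growth currency: `ClassicalMuVanishes κ` yields a linear law with slope `≥ 1`.
[cite: Lang1990, Ch. 5 §1 Thm. 1.2 (iii)] [cite: Washington1997, §13.3 Thm. 13.13] -/
theorem exists_linear_growth_one_le_slope_of_classicalMuVanishes (hK2 : ¬ 2 ∣ Module.finrank ℚ K) (hrank : Units.rank K = 1)
    (κ : ZpExtension K 2) (hκ : κ.IsCyclotomic)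
    (hodd : ∀ w : HeightOneSpectrum (𝓞 K), ((2 : ℕ) : 𝓞 K) ∈ w.asIdeal → Odd (w.asIdeal.ramificationIdx ℤ))
    (h3 : 3 ≤ {w : HeightOneSpectrum (𝓞 K) | ((2 : ℕ) : 𝓞 K) ∈ w.asIdeal}.ncard) (hμ : ClassicalMuVanishes κ) :
    ∃ (l : ℕ) (ν : ℤ) (n₀ : ℕ), 1 ≤ l ∧ ∀ n, n₀ ≤ n → (classNumberPExp κ n : ℤ) = l * n + ν := by
  obtain ⟨l, ν, n₀, h⟩ := hμ
  exact ⟨l, ν, n₀, one_le_slope_of_linear_growth hK2 hrank κ hκ hodd h3 h, h⟩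

end Fukuda

/-! ## §4 Cubic currency: complex cubic fields with three places above `2` (the Kilford cubic fields) -/

section Cubic

variable (F : Type) [Field F] [NumberField F]

/-- **`e_n ≥ e_0 + n − 1` along the cyclotomic `ℤ₂`-tower of a complex cubic field in which `2` splits completely** (`F` cubic with one real
place and three places above `2`; `κ` cyclotomic): `e_0(κ) + n ≤ e_n(κ) + 1` for every `n` — the `2`-part of `h(F_n)` is unbounded.
[cite: Lang1990, Ch. 13 §4, Lemma 4.1–4.2 (PDF pp. 203–204)] [cite: Washington1997, §13.1] -/
theorem classNumberPExp_zero_add_le_layer_of_cubic (hF : Module.finrank ℚ F = 3) (h1 : InfinitePlace.nrRealPlaces F = 1)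
    (h3 : 3 ≤ {v : HeightOneSpectrum (𝓞 F) | ((2 : ℕ) : 𝓞 F) ∈ v.asIdeal}.ncard)
    (κ : ZpExtension F 2) (hκ : κ.IsCyclotomic) (n : ℕ) : classNumberPExp κ 0 + n ≤ classNumberPExp κ n + 1 :=
  classNumberPExp_zero_add_le_layer_of_three_le (by rw [hF]; norm_num) (units_rank_eq_one_of_nrRealPlaces_eq_one F hF h1) κ hκ
    (fun w hw => by rw [ramificationIdx_eq_one_of_three_le_ncard F hF h3 w hw]; exact odd_one) h3 n

/-- **The `2`-class number jumps at EVERY layer** of the cyclotomic `ℤ₂`-tower of a complex cubic field in which `2` splits completely: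
`e_{n+1}(κ) ≠ e_n(κ)` for all `n` (g25's `e₁ ≠ e₀`-type parity obstruction at every layer, via Fukuda's Thm. 1 (1)).
[cite: Fukuda1994, Thm. 1 (1), p. 264] [cite: Lang1990, Ch. 13 §4, Lemma 4.1] -/
theorem classNumberPExp_succ_ne_of_cubic (hF : Module.finrank ℚ F = 3) (h1 : InfinitePlace.nrRealPlaces F = 1)
    (h3 : 3 ≤ {v : HeightOneSpectrum (𝓞 F) | ((2 : ℕ) : 𝓞 F) ∈ v.asIdeal}.ncard)
    (κ : ZpExtension F 2) (hκ : κ.IsCyclotomic) (n : ℕ) : classNumberPExp κ (n + 1) ≠ classNumberPExp κ n :=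
  classNumberPExp_succ_ne (by rw [hF]; norm_num) (units_rank_eq_one_of_nrRealPlaces_eq_one F hF h1) κ hκ
    (fun w hw => by rw [ramificationIdx_eq_one_of_three_le_ncard F hF h3 w hw]; exact odd_one) h3 n

/-- **The ORDER form of the two-layer certificate is void** on such a field: no cyclotomic `κ` and no `n` with `e_{n+1}(κ) = e_n(κ)`.
[cite: Fukuda1994, Thm. 1 (1), p. 264] -/
theorem not_exists_classNumberPExp_succ_eq_of_cubic (hF : Module.finrank ℚ F = 3) (h1 : InfinitePlace.nrRealPlaces F = 1)
    (h3 : 3 ≤ {v : HeightOneSpectrum (𝓞 F) | ((2 : ℕ) : 𝓞 F) ∈ v.asIdeal}.ncard)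
    (κ : ZpExtension F 2) (hκ : κ.IsCyclotomic) : ¬ ∃ n : ℕ, classNumberPExp κ (n + 1) = classNumberPExp κ n :=
  fun ⟨n, hn⟩ => classNumberPExp_succ_ne_of_cubic F hF h1 h3 κ hκ n hn

/-- **`μ₂(F^{cyc}) = 0 ⟹ λ₂ ≥ 1`** for a complex cubic field in which `2` splits completely (growth form).
[cite: Lang1990, Ch. 5 §1 Thm. 1.2 (iii)] [cite: Washington1997, §13.3 Thm. 13.13] -/
theorem one_le_slope_of_classicalMuVanishes_of_cubic (hF : Module.finrank ℚ F = 3) (h1 : InfinitePlace.nrRealPlaces F = 1)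
    (h3 : 3 ≤ {v : HeightOneSpectrum (𝓞 F) | ((2 : ℕ) : 𝓞 F) ∈ v.asIdeal}.ncard)
    (κ : ZpExtension F 2) (hκ : κ.IsCyclotomic) (hμ : ClassicalMuVanishes κ) :
    ∃ (l : ℕ) (ν : ℤ) (n₀ : ℕ), 1 ≤ l ∧ ∀ n, n₀ ≤ n → (classNumberPExp κ n : ℤ) = l * n + ν :=
  exists_linear_growth_one_le_slope_of_classicalMuVanishes (by rw [hF]; norm_num)
    (units_rank_eq_one_of_nrRealPlaces_eq_one F hF h1) κ hκ
    (fun w hw => by rw [ramificationIdx_eq_one_of_three_le_ncard F hF h3 w hw]; exact odd_one) h3 hμ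

end Cubic

/-! ## §5 Crux C2: the cubic `2`-torsion field of a seed-cell curve with `Δ_W < 0` on the Kilford stratum -/

section Seed

open WeierstrassCurve Polynomial IntermediateField
  Literature.NumberTheory.EllipticCurves.Greenberg1999
  Summit.BirchSwinnertonDyer.Rank1Residual

variable (W : WeierstrassCurve ℚ) [W.IsElliptic]

/-- **THE KILFORD SEEDS' CUBIC TOWER JUMPS AT EVERY LAYER.** `W/ℚ` elliptic with `Δ_W < 0` and no rational `2`-torsion abscissa, `β` a root
of the `2`-division cubic, THREE places above `2` in `ℚ(β)` (the displayed bit `h3p` of att-p5 g25's doors; for a good ordinary `W` it is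
`Δ_W ≡ 1 (mod 8)`, the case of all twelve certified seeds): for every cyclotomic `ℤ₂`-extension `κP` of `ℚ(β)` and every `n`,
`e_0(κP) + n ≤ e_n(κP) + 1` and `e_{n+1}(κP) ≠ e_n(κP)`. [cite: Lang1990, Ch. 13 §4, Lemma 4.1–4.2] [cite: Fukuda1994, Thm. 1 (1), p. 264]
[cite: Cohen1993, Prop. 4.8.11] -/
theorem classNumberPExp_layer_growth_seedCubicField (hΔ : W.Δ < 0) (ht : ∀ x : ℚ, ¬ HasRationalTwoTorsionX W x)
    {β : AlgebraicClosure ℚ} (hβ : aeval β W.twoTorsionPolynomial.toPoly = 0)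
    (h3p : 3 ≤ {v : HeightOneSpectrum (𝓞 ↥(IntermediateField.adjoin ℚ ({β} : Set (AlgebraicClosure ℚ)))) |
      ((2 : ℕ) : 𝓞 ↥(IntermediateField.adjoin ℚ ({β} : Set (AlgebraicClosure ℚ)))) ∈ v.asIdeal}.ncard)
    (κP : ZpExtension ↥(IntermediateField.adjoin ℚ ({β} : Set (AlgebraicClosure ℚ))) 2) (hκP : κP.IsCyclotomic) (n : ℕ) :
    classNumberPExp κP 0 + n ≤ classNumberPExp κP n + 1 ∧ classNumberPExp κP (n + 1) ≠ classNumberPExp κP n := by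
  have hirr := AlignedTransportAtTwoSeed.irr_two_of_forall_not_hasRationalTwoTorsionX W ht
  have hβint : IsIntegral ℚ β := ((AlgebraicClosure.isAlgebraic ℚ).isAlgebraic β).isIntegral
  haveI : FiniteDimensional ℚ ↥(IntermediateField.adjoin ℚ ({β} : Set (AlgebraicClosure ℚ))) :=
    IntermediateField.adjoin.finiteDimensional hβint
  haveI : NumberField ↥(IntermediateField.adjoin ℚ ({β} : Set (AlgebraicClosure ℚ))) := NumberField.mk
  have h3 : Module.finrank ℚ ↥(IntermediateField.adjoin ℚ ({β} : Set (AlgebraicClosure ℚ))) = 3 :=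
    AddKatoTwo.finrank_adjoin_root_twoTorsionPolynomial_eq_three W hirr hβ
  have h1 := nrRealPlaces_adjoin_root_twoTorsionPolynomial_eq_one W hΔ hirr hβ
  exact ⟨classNumberPExp_zero_add_le_layer_of_cubic _ h3 h1 h3p κP hκP n, classNumberPExp_succ_ne_of_cubic _ h3 h1 h3p κP hκP n⟩

/-- **THE ORDER-FORM LAYER DOOR IS DEAD ON THE KILFORD STRATUM.** Under the same hypotheses, the displayed certificate of
`…CubicLayerOneDoors.mazurMainConjecture_two_of_muIneqRel_of_threePrimes_of_classNumberPExp_succ_eq` — «for every cyclotomic `κP` of `ℚ(β)`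
SOME `n` with `e_{n+1}(κP) = e_n(κP)`» — is FALSE (a cyclotomic `ℤ₂`-extension of `ℚ(β)` exists: the restriction of that of `ℚ`, onto as
`[ℚ(β) : ℚ] = 3` is odd). Only the RANK form (`…_of_classGroupPRank_succ_eq`, Fukuda's Thm. 1 (2)) can certify `μ₂(ℚ(β)^{cyc}) = 0` there.
[cite: Fukuda1994, Thm. 1 (1)(2), p. 264] [cite: Washington1997, §13.1] -/
theorem not_forall_exists_classNumberPExp_succ_eq_seedCubicField (hΔ : W.Δ < 0) (ht : ∀ x : ℚ, ¬ HasRationalTwoTorsionX W x)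
    {β : AlgebraicClosure ℚ} (hβ : aeval β W.twoTorsionPolynomial.toPoly = 0)
    (h3p : 3 ≤ {v : HeightOneSpectrum (𝓞 ↥(IntermediateField.adjoin ℚ ({β} : Set (AlgebraicClosure ℚ)))) |
      ((2 : ℕ) : 𝓞 ↥(IntermediateField.adjoin ℚ ({β} : Set (AlgebraicClosure ℚ)))) ∈ v.asIdeal}.ncard) :
    ¬ ∀ κP : ZpExtension ↥(IntermediateField.adjoin ℚ ({β} : Set (AlgebraicClosure ℚ))) 2, κP.IsCyclotomic →
      ∃ n : ℕ, classNumberPExp κP (n + 1) = classNumberPExp κP n := by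
  have hirr := AlignedTransportAtTwoSeed.irr_two_of_forall_not_hasRationalTwoTorsionX W ht
  have hβint : IsIntegral ℚ β := ((AlgebraicClosure.isAlgebraic ℚ).isAlgebraic β).isIntegral
  haveI : FiniteDimensional ℚ ↥(IntermediateField.adjoin ℚ ({β} : Set (AlgebraicClosure ℚ))) :=
    IntermediateField.adjoin.finiteDimensional hβint
  haveI : NumberField ↥(IntermediateField.adjoin ℚ ({β} : Set (AlgebraicClosure ℚ))) := NumberField.mk
  have h3 : Module.finrank ℚ ↥(IntermediateField.adjoin ℚ ({β} : Set (AlgebraicClosure ℚ))) = 3 :=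
    AddKatoTwo.finrank_adjoin_root_twoTorsionPolynomial_eq_three W hirr hβ
  have hodd3 : ¬ 2 ∣ Module.finrank ℚ ↥(IntermediateField.adjoin ℚ ({β} : Set (AlgebraicClosure ℚ))) := by rw [h3]; norm_num
  -- a cyclotomic `ℤ₂`-extension of `ℚ(β)` exists
  have hsurj := ZpExtension.surjective_comp_absGaloisRestrict_of_not_dvd_finrank (CyclotomicZp.zpExtension 2)
    ↥(IntermediateField.adjoin ℚ ({β} : Set (AlgebraicClosure ℚ))) hodd3
  have hcyc : ((CyclotomicZp.zpExtension 2).restrict ↥(IntermediateField.adjoin ℚ ({β} : Set (AlgebraicClosure ℚ))) hsurj).IsCyclotomic :=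
    ZpExtension.isCyclotomic_restrict _ (CyclotomicZp.isCyclotomic_zpExtension 2) _ hsurj
  intro hall
  obtain ⟨n, hn⟩ := hall _ hcyc
  exact (classNumberPExp_layer_growth_seedCubicField W hΔ ht hβ h3p _ hcyc n).2 hn

end Seed

end Summit.BirchSwinnertonDyer.BirchSwinnertonDyer.Theorems.AlignedTransportAtTwoCubicTowerJumps

end
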